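import Mathlib
import HarnessLib

/-! # `Balaban1983to89.B13PerturbativeStep` — [Balaban1988RG2Cluster] pp. 15–17, the "perturbative argument"
(2.15)–(2.17), (2.21), (2.24)–(2.25): its STRUCTURAL inferences KERNEL-CHECKED for finite matrices — the modulus of
a complex Gaussian weight (2.15); the (2.16)-shape localisation bound is a submultiplicative weighted row norm and is
INHERITED by Neumann inverses and by differences of perturbed inverses («R₂ … R₃ satisfying (2.16)»); determinant
quotients of perturbed operators are `exp(±O(θ)·#sites)` (2.17), by the Leibniz row-sum bound; the Schur / AM–GM
form bound (2.21); the symmetric-case determinant factor of (2.24) lies in `[1, exp(2α₅‖C‖·#sites)]`; the scalar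
Gaussian factor of (2.25).  The smallness LEAF `θ = O(1)e^{−δ₀M/3} + O(α₀+α₁)` of (2.16) itself is NOT reproduced
(located below).

statement-level skeleton of published theorems with citation tags; proofs where landed; nothing here is a claim about the Yang–Mills mass gap

CITATION HEADER (lean-in-tree rule 2026-08-18).  Source: T. Bałaban, *Renormalization group approach to lattice
gauge field theories. II. Cluster expansions*, Commun. Math. Phys. **116**, 1–22 (1988) [`Balaban1988RG2Cluster`]
(cell paper B13; held: `paper:balaban1988-cmp116-rg-ii-cluster`, journal page = PDF page; quotations read from the
page renders `b2b-balaban-ref1/pages/1988-cmp116-rg-II-cluster/1988-cmp116-rg-II-cluster-p015-x2.png`,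
`…-p016-x2.png`, `…-p017-x2.png`, the publisher's text layer being garbled).  p. 15 [PDF 15], verbatim: *"We
consider it as an analytic function of (U, J) in the space U^c_{k+1}(X, α₀, α₁), and of the complex parameters
σ(Z), τ. This complicates estimates of this expression, because the operators in it are not symmetric, and the
second measure is complex. … For the pair (U, 0) the operators are symmetric, and the measure is positive, and then
the estimates are simpler. The general case is handled by a perturbative argument. The first estimate is"* (2.15)
[label printed «(7.14)»; it bounds the modulus of (2.14) by the same expression with `Re` inserted in the first
Gaussian exponent, the factor `|det(C^{(k)}(Z₀,σ(Z))⁻¹)/det(Re C^{(k)}(Z₀,σ(Z))⁻¹)|^{1/2}`, the Gaussian measure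
of covariance `(Re C^{(k)}(Z₀,σ(Z))⁻¹)⁻¹` in `B`, `exp(−⟨B, Re Γ_k(Z₀,σ(Z))X⟩)` and moduli `|τ(Y)|`, `|V_k(Y,B)|` in
the last exponent]; *"In the expression on the right-hand side we replace the
operators by the corresponding operators with σ(Z) = 0, U = U, J = 0, and we estimate the error. For the quadratic
form in the first exponential the difference is a quadratic form ½⟨X, R₁X⟩, with matrix elements satisfying the
bound `|R₁(b, b′)| ≦ (O(1)e^{−(1/3)δ₀M} + O(α₀ + α₁)) exp(−½δ₀|b₋ − b′₋|)`. (2.16) We have assumed, as in Sect. 1,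
that M is much bigger than κ₁, especially that e^{−(1/3)δ₀M}e^{16κ₁} < 1. The determinants in the next factor are
equal for the new operators, hence this factor can be estimated by `exp((O(1)e^{−(1/3)δ₀M} + O(α₀ + α₁))|Z₀|)`.
(2.17) Similarly, the next Gaussian measure is replaced by the measure with the new covariance, multiplied by a
quotient of determinants, which can be estimated by (2.17), and by the function exp ½⟨B, R₂B⟩ with R₂ satisfying
(2.16). In the second exponential the difference between the new bilinear form and the form in (2.15) is a
bilinear from −⟨B, R₃X⟩ with R₃ satisfying (2.16)."*  p. 16 [PDF 16]: *"The other quadratic forms, i.e. the forms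
R₁, R₂, R₃, can be bounded in a similar way using (2.16), by the forms ½(O(1)e^{−(1/3)δ₀M} + O(α₀ + α₁))(‖ZX‖² +
‖Z₀B‖²). (2.21)"*  p. 17 [PDF 17]: (2.24) `… = |det(C^{(k)}(Z₀,0)⁻¹)/det(C^{(k)}(Z₀,0)⁻¹ − α₅I)|^{1/2}
exp(½⟨Γ_k(Z₀,0)X, (C^{(k)}(Z₀,0)⁻¹ − α₅I)⁻¹Γ_k(Z₀,0)X⟩)`; *"Of course we have assumed that α₅ is sufficiently
small, e.g. α₅‖C^{(k)}(Z₀,0)‖ < ½. The factor with the determinants can be estimated by exp O(1)α₅|Z₀|. … The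
remainder can be estimated by ½O(α₅)‖ZX‖²."*; (2.25) `∫dμ₀(X)|_Z exp ½O(α₅)‖ZX‖² = Π_{b∈Z}(1 − O(α₅))^{½d(𝔤)}
≦ exp(O(α₅)|Z|)` [sic: the exponent is `−½d(𝔤)`].

WHAT IS REPRODUCED (unit `b2b-balaban-b13-g5`; cell GAPS.md G-B13-05 (b), (c); the sibling modules `…B13`,
`…B13Closing`, `…B13Sqrt27` are NOT modified).  TYPING: an "operator on Z₀" is a square matrix over an abstract
finite index type `n` (in print: bonds of `Z₀` × colour components, `#n = d(𝔤)·(number of bonds)`, so every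
`Fintype.card n` below reads `O(1)|Z₀|`); scalars `𝕜 = ℝ` or `ℂ` (`RCLike 𝕜`); the weight `exp(½δ₀|b₋ − b′₋|)` of
(2.16) is `exp(κ·d(i,j))` for a pseudo-metric `d` and `κ ≥ 0` (`WeightHyp`); "a (2.16)-type bound with constant
θ" := `WRS κ d R θ` := every weighted absolute row sum `Σ_j ‖R i j‖ e^{κ d(i,j)}` is `≤ θ` (it implies the printed
ENTRYWISE form `‖R i j‖ ≤ θ e^{−κ d(i,j)}`, `WRS.norm_apply_le`; the converse, at any smaller rate and up to a
lattice constant `Σ_{b′} e^{−(κ−κ′)|b−b′|}`, is not typed here).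
§1 (2.15): for a complex matrix `A` and a REAL vector `v`, `Re⟨v, Av⟩ = ⟨v, (Re A)v⟩` and `|exp(−½⟨v, Av⟩)| =
exp(−½⟨v, (Re A)v⟩)` (`re_quadForm`, `norm_cexp_neg_half_quadForm`); taking real parts does not increase the
weighted row norm (`wrs_map_re_le`).
§2 the weighted row norm `wrs`: subadditive, absolutely homogeneous, `= 1` on `1`, SUBMULTIPLICATIVE (`WRS.mul`, by
the triangle inequality for `d`; `WRS.pow`) — the algebra behind "operators with (2.16)-type kernels compose".
§3 NEUMANN INVERSION WITHOUT SERIES: if `WRS κ d A ρ` with `ρ < 1` then `1 − A` is invertible (`isUnit_one_sub`, a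
maximal-coordinate argument) and, from the fixed-point equation `(1 − A)⁻¹ = 1 + A(1 − A)⁻¹` alone,
`WRS (1 − A)⁻¹ (1 − ρ)⁻¹` and `WRS ((1 − A)⁻¹ − 1) (ρ(1 − ρ)⁻¹)` (`WRS.inv_one_sub`, `WRS.inv_one_sub_sub_one`;
`1 + A` versions).  PERTURBED INVERSES (the source of «R₂ satisfying (2.16)», «R₃ satisfying (2.16)» and of the
determinant quotients: inverses and sandwiches of the perturbed covariance): if `M₀` is invertible, `WRS M₀⁻¹ K`,
`WRS R θ` and `Kθ < 1`, then `M₀ + R` is invertible, `WRS (M₀ + R)⁻¹ ((1 − Kθ)⁻¹K)` and `WRS ((M₀ + R)⁻¹ − M₀⁻¹)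
(Kθ(1 − Kθ)⁻¹K)`, so ENTRYWISE `‖((M₀ + R)⁻¹ − M₀⁻¹) i j‖ ≤ Kθ(1 − Kθ)⁻¹K·e^{−κ d(i,j)}` (`isUnit_add`,
`WRS.inv_add`, `WRS.inv_add_sub_inv`, `norm_inv_add_sub_inv_apply_le`): a (2.16)-type bound with constant `θ` on a
perturbation is inherited, with constant `O(K²)θ`, by the difference of the inverses.
§4 (2.17): the Leibniz bound `‖det M‖ ≤ Π_i Σ_j ‖M i j‖` (`norm_det_le_prod_rowSum`; any `RCLike` field — compare the
tree's ℓ²-Hadamard inequality `Literature.Analysis.Matrix.HadamardInequality`, not used here), hence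
`‖det(1 + A)‖ ≤ exp(Σ_{ij} ‖A i j‖) ≤ exp(#n·ρ)` (`norm_det_one_add_le_exp`, `…_card`) and the TWO-SIDED bound
`e^{−#n·Kθ/(1−Kθ)} ≤ ‖det(M₀ + R)‖/‖det M₀‖ ≤ e^{#n·Kθ}` (`norm_det_add_le`, `norm_det_le_norm_det_add`,
`det_ratio_bounds`, `sqrt_det_ratio_le`) — (2.17) with `|Z₀| ↔ #n`, for BOTH printed uses (the quotient
`det A/det Re A` in (2.15), `A = C^{(k)}(Z₀,σ(Z))⁻¹ = A₀ + E`, `Re A = A₀ + Re E`, `A₀ = C^{(k)}(Z₀,0)⁻¹` real —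
"the determinants … are equal for the new operators"; and the "quotient of determinants" of the two real
covariances), GIVEN a (2.16)-type bound on `E`.
§5 (2.21): the Schur / AM–GM bound `‖Σ_{ij} v_i R_{ij} w_j‖ ≤ ½(r·Σ_i ‖v_i‖² + c·Σ_j ‖w_j‖²)` from row sums `≤ r`
and column sums `≤ c` (`norm_bilinForm_le`; row sums `≤` weighted ones, `rowSum_le_wrs`) — the printed shape
`½θ(‖ZX‖² + ‖Z₀B‖²)`.
§6 (2.24)–(2.25), the symmetric case: for a real positive definite `C` with eigenvalues `λ_k`, `α ≥ 0` and
`αλ_k ≤ ½` (the printed `α₅‖C^{(k)}(Z₀,0)‖ < ½`): `det(1 − αC) = Π_k (1 − αλ_k)`, `det C⁻¹/det(C⁻¹ − αI) =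
(Π_k (1 − αλ_k))⁻¹ ∈ [1, exp(2αΣ_k λ_k)] ⊆ [1, exp(2α·c·#n)]` when `λ_k ≤ c` (`det_one_sub_smul_eq_prod`,
`det_ratio_eq_prod_inv`, `det_ratio_mem_Icc`, `det_ratio_le_exp_card`: "estimated by exp O(1)α₅|Z₀|" with
`O(1) = ‖C‖` explicit); `(C⁻¹ − αI)⁻¹ = (1 − αC)⁻¹C` (`inv_inv_sub_smul_eq`) with the scalar remainder inequality
`λ(1 − αλ)⁻¹ − λ ≤ 2αλ²` on the spectrum (`remainder_scalar_le`: "the remainder can be estimated by ½O(α₅)‖ZX‖²");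
and the one-coordinate Gaussian factor of (2.25), `(2π)^{−1/2}∫ e^{−x²/2}e^{ax²/2}dx = (1 − a)^{−1/2}` (`a < 1`)
with `((1 − a)⁻¹)^{N}` having square root `≤ e^{aN}` for `0 ≤ a ≤ ½` (`gaussian_exp_sq_integral`,
`sqrt_inv_one_sub_pow_le`; the omitted sign of the printed exponent is `−`, cell DIVERGENCE D-b13.13).
NOT REPRODUCED — LOCATED (cell ABSOLUTE RULE: an assertion of the audited paper is never a fact): the LEAF of the
perturbative argument, i.e. that the differences `E` between the analytically continued operators
`C^{(k)}(Z₀,σ(Z))^{±1}`, `(C^{(k)})^{1/2}(σ(Z))`, `Δ_k(σ(Z))`, `Γ_k(Z₀,σ(Z))` and their values at `σ(Z) = 0`,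
`J = 0` obey a (2.16)-type bound with `θ = O(1)e^{−δ₀M/3} + O(α₀+α₁)`; in print this rests on the analyticity of the
random-walk expansions in `(U, J) ∈ U^c_{k+1}(X, α₀, α₁)` and in `σ`, uniformly localised (cell GAPS G-B13-05 (a),
G-IF-10, G-B9-10), followed by a Cauchy estimate (Mathlib: `Complex.norm_deriv_le_of_forall_mem_sphere_norm_le`,
`Complex.dist_le_div_mul_dist_of_mapsTo_ball`).  GIVEN that leaf, §3–§5 turn (2.16) ⇒ «R₂, R₃ satisfy (2.16)»,
(2.17), (2.21) into theorems — and §7 (v2) isolates it further: GIVEN only analyticity in a complex parameter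
`σ` on a disc `|σ| < R` with ONE localised majorant (`‖A σ i j‖ ≤ m i j`, `Σ_j m i j e^{κd(i,j)} ≤ ρ`), the
differences `A σ − A 0` obey the (2.16)-type bound with constant `(2ρ/R)|σ|` by the Schwarz lemma
(`WRS.sub_apply_zero_of_differentiableOn`, `WRS.inv_sub_inv_of_differentiableOn`), so the residual is exactly
the analytic, uniformly localised expansion of the complexified operators (G-IF-10 / G-B9-10), nothing else.
§7 also types the passage entrywise decay ⇒ weighted row sums at a smaller rate under a lattice-sum hypothesis
(`WRS.of_entrywise`) and the FORM version of the (2.24) remainder, `0 ≤ ⟨w, ((1 − αC)⁻¹C − C)w⟩ ≤ 2αc⟨w, Cw⟩`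
(`remainder_form_le`).  Still not typed: the complex `τ` (it enters only through `|τ(Y)|`), the several complex
parameters `(U′, J, σ)` at once (one disc at a time here), and the lattice sum `Σ_{b′} e^{−(κ−κ′)|b₋−b′₋|} = O(1)`.
Value = kernel certificate of the structural steps of a printed argument + precisely located residual, NOT summit
progress.  Elementary linear algebra; statements specific to a display are tagged [cite: Balaban1988RG2Cluster,
(2.1x) p.1y] as use-site locators, the rest [folklore].

v1.2 (unit `lit-balaban-r10` gen 17; every declaration and statement byte-identical, two proof bodies changed,
referee ref-3 N-g45-2): the page-1 framing sentence added above; the cross-trunk `import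
Literature.NumberTheory.LFunctions.NicolasOmega` DROPPED — the one elementary inequality it supplied,
`e^{−2t} ≤ 1 − t` for `0 ≤ t ≤ ½`, is re-derived inline from Mathlib's `Real.add_one_le_exp` in
`det_ratio_mem_Icc` (§6) and `sqrt_inv_one_sub_pow_le` (§6).  That import had put a 16-module closure of the
number-theory trunk under all 278 transitive importers of this file (an import-graph and by-name scan of those 278
found no other use of it; its only downstream by-name use, `B13Integral223.outer_225_le`, was inlined first, v1.2
of that file).
-/

noncomputable section

open Matrix Finset MeasureTheory
open scoped Real

namespace Literature.MathematicalPhysics.QuantumFieldTheory.Balaban1983to89.B13PerturbativeStep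

/-! ## §1. (2.15): the modulus of a complex Gaussian weight at a real field is the weight of the real part -/

section modulus

variable {n : Type*} [Fintype n]

/-- The real part of a complex quadratic form at a REAL vector is the quadratic form of the entrywise real part:
`Re Σ v_i A_{ij} v_j = Σ v_i (Re A_{ij}) v_j`. [folklore] -/
theorem re_quadForm (A : Matrix n n ℂ) (v : n → ℝ) :
    (∑ i, ∑ j, (v i : ℂ) * A i j * (v j : ℂ)).re = ∑ i, ∑ j, v i * (A i j).re * v j := by
  simp [Complex.re_sum, Complex.mul_re, Complex.mul_im]

/-- **(2.15), first factor**: `|exp(−½⟨v, Av⟩)| = exp(−½⟨v, (Re A)v⟩)` for a complex matrix `A` and a real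
vector `v` — the modulus of the complex Gaussian weight is the Gaussian weight of `Re A`.
[cite: Balaban1988RG2Cluster, (2.15) p.15] -/
theorem norm_cexp_neg_half_quadForm (A : Matrix n n ℂ) (v : n → ℝ) :
    ‖Complex.exp (-(1 / 2 : ℂ) * ∑ i, ∑ j, (v i : ℂ) * A i j * (v j : ℂ))‖
      = Real.exp (-(1 / 2 : ℝ) * ∑ i, ∑ j, v i * (A i j).re * v j) := by
  rw [Complex.norm_exp, ← re_quadForm]
  congr 1
  have h : (-(1 / 2 : ℂ)) = ((-(1 / 2 : ℝ) : ℝ) : ℂ) := by push_cast; ring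
  rw [h, Complex.re_ofReal_mul]

/-- The modulus of a complex exponential weight with a REAL coefficient: `|exp(t·z)| = exp(t·Re z)` — the shape of
every other factor of (2.15) (bilinear term `−⟨B, WX⟩`, sources). [folklore] -/
theorem norm_cexp_ofReal_mul (t : ℝ) (z : ℂ) : ‖Complex.exp (t * z)‖ = Real.exp (t * z.re) := by
  rw [Complex.norm_exp, Complex.re_ofReal_mul]

end modulus

/-! ## §2. The (2.16)-shape bound as a weighted row norm: `Σ_j ‖A i j‖ e^{κ d(i,j)} ≤ ρ` -/

section wrs

variable {𝕜 : Type*} [RCLike 𝕜] {n : Type*} [Fintype n] [DecidableEq n]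

/-- The `e^{κ d}`-weighted absolute row sum of row `i` of `A`: `Σ_j ‖A i j‖ e^{κ d(i,j)}`. [folklore] -/
def wrs (κ : ℝ) (d : n → n → ℝ) (A : Matrix n n 𝕜) (i : n) : ℝ := ∑ j, ‖A i j‖ * Real.exp (κ * d i j)

/-- `WRS κ d A ρ`: every `e^{κ d}`-weighted absolute row sum of `A` is `≤ ρ` — the typed form of "a bound of type
(2.16) with constant `ρ` and rate `κ`". [cite: Balaban1988RG2Cluster, (2.16) p.16] -/
def WRS (κ : ℝ) (d : n → n → ℝ) (A : Matrix n n 𝕜) (ρ : ℝ) : Prop := ∀ i, wrs κ d A i ≤ ρ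

/-- The hypotheses on the weight: `κ ≥ 0` and `d` a pseudo-metric (zero diagonal, nonnegative, triangle
inequality; symmetry is never used).  In print `κ = ½δ₀`, `d(b, b′) = |b₋ − b′₋|`. [folklore] -/
structure WeightHyp (κ : ℝ) (d : n → n → ℝ) : Prop where
  κ_nonneg : 0 ≤ κ
  zero : ∀ i, d i i = 0
  nonneg : ∀ i j, 0 ≤ d i j
  tri : ∀ i j k, d i k ≤ d i j + d j k

variable {κ : ℝ} {d : n → n → ℝ}

omit [DecidableEq n] in
/-- Weighted row sums are nonnegative. [folklore] -/
theorem wrs_nonneg (A : Matrix n n 𝕜) (i : n) : 0 ≤ wrs κ d A i :=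
  Finset.sum_nonneg fun _ _ => mul_nonneg (norm_nonneg _) (Real.exp_pos _).le

omit [DecidableEq n] in
/-- A `WRS` constant is nonnegative (as soon as the index type is inhabited). [folklore] -/
theorem WRS.nonneg {A : Matrix n n 𝕜} {ρ : ℝ} (h : WRS κ d A ρ) (i : n) : 0 ≤ ρ :=
  (wrs_nonneg A i).trans (h i)

omit [DecidableEq n] in
/-- One weighted entry is bounded by the weighted row sum. [folklore] -/
theorem norm_mul_exp_le_wrs (A : Matrix n n 𝕜) (i j : n) :
    ‖A i j‖ * Real.exp (κ * d i j) ≤ wrs κ d A i :=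
  Finset.single_le_sum (f := fun j => ‖A i j‖ * Real.exp (κ * d i j))
    (fun _ _ => mul_nonneg (norm_nonneg _) (Real.exp_pos _).le) (Finset.mem_univ j)

omit [DecidableEq n] in
/-- **`WRS` ⇒ the printed entrywise form of (2.16)**: `‖A i j‖ ≤ ρ e^{−κ d(i,j)}`.
[cite: Balaban1988RG2Cluster, (2.16) p.16] -/
theorem WRS.norm_apply_le {A : Matrix n n 𝕜} {ρ : ℝ} (h : WRS κ d A ρ) (i j : n) :
    ‖A i j‖ ≤ ρ * Real.exp (-(κ * d i j)) := by
  rw [Real.exp_neg, ← div_eq_mul_inv, le_div_iff₀ (Real.exp_pos _)]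
  exact (norm_mul_exp_le_wrs A i j).trans (h i)

omit [DecidableEq n] in
/-- Unweighted row sums are bounded by weighted ones (weights `≥ 1`). [folklore] -/
theorem rowSum_le_wrs (hw : WeightHyp κ d) (A : Matrix n n 𝕜) (i : n) : ∑ j, ‖A i j‖ ≤ wrs κ d A i :=
  Finset.sum_le_sum fun j _ =>
    le_mul_of_one_le_right (norm_nonneg _) (Real.one_le_exp (mul_nonneg hw.κ_nonneg (hw.nonneg i j)))

omit [DecidableEq n] in
/-- Entries are bounded by the `WRS` constant. [folklore] -/
theorem WRS.norm_apply_le' (hw : WeightHyp κ d) {A : Matrix n n 𝕜} {ρ : ℝ} (h : WRS κ d A ρ) (i j : n) :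
    ‖A i j‖ ≤ ρ :=
  ((Finset.single_le_sum (f := fun j => ‖A i j‖) (fun _ _ => norm_nonneg _) (Finset.mem_univ j)).trans
    (rowSum_le_wrs hw A i)).trans (h i)

omit [DecidableEq n] in
/-- Subadditivity of the weighted row sum. [folklore] -/
theorem wrs_add_le (A B : Matrix n n 𝕜) (i : n) : wrs κ d (A + B) i ≤ wrs κ d A i + wrs κ d B i := by
  unfold wrs
  rw [← Finset.sum_add_distrib]
  exact Finset.sum_le_sum fun j _ => by
    rw [← add_mul, Matrix.add_apply]
    exact mul_le_mul_of_nonneg_right (norm_add_le _ _) (Real.exp_pos _).le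

omit [DecidableEq n] in
/-- `WRS` is subadditive. [folklore] -/
theorem WRS.add {A B : Matrix n n 𝕜} {ρ σ : ℝ} (hA : WRS κ d A ρ) (hB : WRS κ d B σ) :
    WRS κ d (A + B) (ρ + σ) :=
  fun i => (wrs_add_le A B i).trans (add_le_add (hA i) (hB i))

omit [DecidableEq n] in
/-- The weighted row sum is invariant under negation. [folklore] -/
theorem wrs_neg (A : Matrix n n 𝕜) (i : n) : wrs κ d (-A) i = wrs κ d A i := by
  simp [wrs]

omit [DecidableEq n] in
/-- `WRS` is invariant under negation. [folklore] -/
theorem WRS.neg {A : Matrix n n 𝕜} {ρ : ℝ} (hA : WRS κ d A ρ) : WRS κ d (-A) ρ :=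
  fun i => (wrs_neg A i).le.trans (hA i)

omit [DecidableEq n] in
/-- Subadditivity for differences. [folklore] -/
theorem wrs_sub_le (A B : Matrix n n 𝕜) (i : n) : wrs κ d (A - B) i ≤ wrs κ d A i + wrs κ d B i := by
  rw [sub_eq_add_neg]
  exact (wrs_add_le A (-B) i).trans (by rw [wrs_neg])

omit [DecidableEq n] in
/-- `WRS` for differences. [folklore] -/
theorem WRS.sub {A B : Matrix n n 𝕜} {ρ σ : ℝ} (hA : WRS κ d A ρ) (hB : WRS κ d B σ) :
    WRS κ d (A - B) (ρ + σ) :=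
  fun i => (wrs_sub_le A B i).trans (add_le_add (hA i) (hB i))

omit [DecidableEq n] in
/-- Absolute homogeneity of the weighted row sum. [folklore] -/
theorem wrs_smul (c : 𝕜) (A : Matrix n n 𝕜) (i : n) : wrs κ d (c • A) i = ‖c‖ * wrs κ d A i := by
  simp [wrs, Finset.mul_sum, mul_assoc]

omit [DecidableEq n] in
/-- `WRS` under scalar multiplication. [folklore] -/
theorem WRS.smul (c : 𝕜) {A : Matrix n n 𝕜} {ρ : ℝ} (hA : WRS κ d A ρ) : WRS κ d (c • A) (‖c‖ * ρ) :=
  fun i => by rw [wrs_smul]; exact mul_le_mul_of_nonneg_left (hA i) (norm_nonneg c)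

omit [DecidableEq n] in
/-- Monotonicity of `WRS` in the constant. [folklore] -/
theorem WRS.mono {A : Matrix n n 𝕜} {ρ σ : ℝ} (hA : WRS κ d A ρ) (h : ρ ≤ σ) : WRS κ d A σ :=
  fun i => (hA i).trans h

omit [DecidableEq n] in
/-- Taking entrywise real parts does not increase the weighted row sum (`|Re z| ≤ |z|`): the matrix `Re E` of
(2.15) inherits the (2.16)-type bound of `E`. [folklore] -/
theorem wrs_map_re_le (A : Matrix n n ℂ) (i : n) : wrs κ d (A.map Complex.re) i ≤ wrs κ d A i :=
  Finset.sum_le_sum fun j _ => mul_le_mul_of_nonneg_right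
    (by rw [Matrix.map_apply, Real.norm_eq_abs]; exact Complex.abs_re_le_norm _) (Real.exp_pos _).le

omit [DecidableEq n] in
/-- `WRS` passes to the entrywise real part. [folklore] -/
theorem WRS.map_re {A : Matrix n n ℂ} {ρ : ℝ} (hA : WRS κ d A ρ) : WRS κ d (A.map Complex.re) ρ :=
  fun i => (wrs_map_re_le A i).trans (hA i)

/-- The identity has weighted row sums `1` (zero diagonal of `d`). [folklore] -/
theorem wrs_one (hw : WeightHyp κ d) (i : n) : wrs κ d (1 : Matrix n n 𝕜) i = 1 := by
  unfold wrs
  rw [Finset.sum_eq_single i (fun j _ hji => by rw [Matrix.one_apply_ne' hji]; simp)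
      (fun h => (h (Finset.mem_univ i)).elim), Matrix.one_apply_eq, hw.zero, mul_zero, Real.exp_zero, norm_one,
    mul_one]

/-- `WRS κ d 1 1`. [folklore] -/
theorem WRS.one (hw : WeightHyp κ d) : WRS κ d (1 : Matrix n n 𝕜) 1 := fun i => (wrs_one hw i).le

omit [DecidableEq n] in
/-- **Submultiplicativity, pointwise form**: `wrs(AB) i ≤ Σ_l ‖A i l‖ e^{κ d(i,l)} · wrs(B) l` (triangle
inequality for `d`, `κ ≥ 0`). [folklore] -/
theorem wrs_mul_le (hw : WeightHyp κ d) (A B : Matrix n n 𝕜) (i : n) :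
    wrs κ d (A * B) i ≤ ∑ l, ‖A i l‖ * Real.exp (κ * d i l) * wrs κ d B l := by
  have hexp : ∀ l j, Real.exp (κ * d i j) ≤ Real.exp (κ * d i l) * Real.exp (κ * d l j) := fun l j => by
    rw [← Real.exp_add]
    exact Real.exp_le_exp.2 (by nlinarith [hw.tri i l j, hw.κ_nonneg])
  calc wrs κ d (A * B) i = ∑ j, ‖∑ l, A i l * B l j‖ * Real.exp (κ * d i j) := by
        simp only [wrs, Matrix.mul_apply]
    _ ≤ ∑ j, ∑ l, ‖A i l‖ * Real.exp (κ * d i l) * (‖B l j‖ * Real.exp (κ * d l j)) := by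
        refine Finset.sum_le_sum fun j _ => ?_
        calc ‖∑ l, A i l * B l j‖ * Real.exp (κ * d i j)
            ≤ (∑ l, ‖A i l‖ * ‖B l j‖) * Real.exp (κ * d i j) := by
              refine mul_le_mul_of_nonneg_right ?_ (Real.exp_pos _).le
              exact (norm_sum_le _ _).trans (le_of_eq (Finset.sum_congr rfl fun l _ => norm_mul _ _))
          _ = ∑ l, ‖A i l‖ * ‖B l j‖ * Real.exp (κ * d i j) := Finset.sum_mul _ _ _
          _ ≤ ∑ l, ‖A i l‖ * Real.exp (κ * d i l) * (‖B l j‖ * Real.exp (κ * d l j)) :=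
              Finset.sum_le_sum fun l _ => by
                calc ‖A i l‖ * ‖B l j‖ * Real.exp (κ * d i j)
                    ≤ ‖A i l‖ * ‖B l j‖ * (Real.exp (κ * d i l) * Real.exp (κ * d l j)) :=
                      mul_le_mul_of_nonneg_left (hexp l j) (by positivity)
                  _ = _ := by ring
    _ = ∑ l, ‖A i l‖ * Real.exp (κ * d i l) * wrs κ d B l := by
        rw [Finset.sum_comm]
        exact Finset.sum_congr rfl fun l _ => (Finset.mul_sum _ _ _).symm

omit [DecidableEq n] in
/-- **The weighted row norm is submultiplicative**: `WRS A ρ → WRS B σ → WRS (AB) (ρσ)` — "operators with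
(2.16)-type kernels compose". [folklore] -/
theorem WRS.mul (hw : WeightHyp κ d) {A B : Matrix n n 𝕜} {ρ σ : ℝ} (hA : WRS κ d A ρ) (hB : WRS κ d B σ) :
    WRS κ d (A * B) (ρ * σ) := fun i => by
  have hσ : 0 ≤ σ := hB.nonneg i
  calc wrs κ d (A * B) i ≤ ∑ l, ‖A i l‖ * Real.exp (κ * d i l) * wrs κ d B l := wrs_mul_le hw A B i
    _ ≤ ∑ l, ‖A i l‖ * Real.exp (κ * d i l) * σ :=
        Finset.sum_le_sum fun l _ => mul_le_mul_of_nonneg_left (hB l) (by positivity)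
    _ = wrs κ d A i * σ := (Finset.sum_mul _ _ _).symm
    _ ≤ ρ * σ := mul_le_mul_of_nonneg_right (hA i) hσ

/-- Powers: `WRS A ρ → WRS (A^m) (ρ^m)` (cf. `B13Sqrt27.weightedRowSum_pow_le`, the real case). [folklore] -/
theorem WRS.pow (hw : WeightHyp κ d) {A : Matrix n n 𝕜} {ρ : ℝ} (hA : WRS κ d A ρ) :
    ∀ m : ℕ, WRS κ d (A ^ m) (ρ ^ m)
  | 0 => by rw [pow_zero, pow_zero]; exact WRS.one hw
  | m + 1 => by rw [pow_succ, pow_succ]; exact (WRS.pow hw hA m).mul hw hA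

/-! ## §3. Neumann inversion without series, and perturbed inverses («R₂, R₃ satisfy (2.16)») -/

omit [DecidableEq n] in
/-- A strict contraction in the weighted row norm has no fixed vector: `A v = v`, `WRS A ρ`, `ρ < 1` ⇒ `v = 0`
(look at a coordinate of maximal modulus). [folklore] -/
theorem eq_zero_of_mulVec_eq (hw : WeightHyp κ d) {A : Matrix n n 𝕜} {ρ : ℝ} (hA : WRS κ d A ρ) (hρ : ρ < 1)
    {v : n → 𝕜} (hv : A *ᵥ v = v) : v = 0 := by
  rcases isEmpty_or_nonempty n with hn | hn
  · exact funext fun i => (IsEmpty.false i).elim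
  obtain ⟨i₀, hi₀⟩ := Finite.exists_max fun i => ‖v i‖
  have h1 : ‖v i₀‖ ≤ ρ * ‖v i₀‖ := by
    calc ‖v i₀‖ = ‖(A *ᵥ v) i₀‖ := by rw [hv]
      _ = ‖∑ j, A i₀ j * v j‖ := by simp only [Matrix.mulVec, dotProduct]
      _ ≤ ∑ j, ‖A i₀ j‖ * ‖v j‖ :=
          (norm_sum_le _ _).trans (le_of_eq (Finset.sum_congr rfl fun j _ => norm_mul _ _))
      _ ≤ ∑ j, ‖A i₀ j‖ * ‖v i₀‖ :=
          Finset.sum_le_sum fun j _ => mul_le_mul_of_nonneg_left (hi₀ j) (norm_nonneg _)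
      _ = (∑ j, ‖A i₀ j‖) * ‖v i₀‖ := (Finset.sum_mul _ _ _).symm
      _ ≤ ρ * ‖v i₀‖ :=
          mul_le_mul_of_nonneg_right ((rowSum_le_wrs hw A i₀).trans (hA i₀)) (norm_nonneg _)
  have h2 : ‖v i₀‖ ≤ 0 := by nlinarith [norm_nonneg (v i₀)]
  funext i
  exact norm_le_zero_iff.1 ((hi₀ i).trans h2)

/-- **`1 − A` is invertible** when `WRS A ρ`, `ρ < 1`. [folklore] -/
theorem isUnit_one_sub (hw : WeightHyp κ d) {A : Matrix n n 𝕜} {ρ : ℝ} (hA : WRS κ d A ρ) (hρ : ρ < 1) :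
    IsUnit (1 - A) := by
  refine Matrix.mulVec_injective_iff_isUnit.1 fun v w hvw => ?_
  have h0 : (1 - A) *ᵥ (v - w) = 0 := by rw [Matrix.mulVec_sub, hvw, sub_self]
  rw [Matrix.sub_mulVec, Matrix.one_mulVec, sub_eq_zero] at h0
  exact sub_eq_zero.1 (eq_zero_of_mulVec_eq hw hA hρ h0.symm)

/-- `1 + A` is invertible when `WRS A ρ`, `ρ < 1`. [folklore] -/
theorem isUnit_one_add (hw : WeightHyp κ d) {A : Matrix n n 𝕜} {ρ : ℝ} (hA : WRS κ d A ρ) (hρ : ρ < 1) :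
    IsUnit (1 + A) := by
  simpa [sub_neg_eq_add] using isUnit_one_sub hw hA.neg hρ

/-- The fixed-point equation of the Neumann inverse: `(1 − A)⁻¹ = 1 + A(1 − A)⁻¹`. [folklore] -/
theorem inv_one_sub_eq (A : Matrix n n 𝕜) (h : IsUnit (1 - A)) : (1 - A)⁻¹ = 1 + A * (1 - A)⁻¹ := by
  have hmul := Matrix.mul_nonsing_inv (1 - A) ((Matrix.isUnit_iff_isUnit_det _).1 h)
  rw [sub_mul, one_mul, sub_eq_iff_eq_add] at hmul
  exact hmul

/-- **Neumann bound without series**: `WRS A ρ`, `ρ < 1` ⇒ `WRS (1 − A)⁻¹ (1 − ρ)⁻¹` — from the fixed-point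
equation at a row of maximal weighted sum. [folklore] -/
theorem WRS.inv_one_sub (hw : WeightHyp κ d) {A : Matrix n n 𝕜} {ρ : ℝ} (hA : WRS κ d A ρ) (hρ : ρ < 1) :
    WRS κ d (1 - A)⁻¹ (1 - ρ)⁻¹ := by
  set B := (1 - A)⁻¹ with hB
  have hfix : B = 1 + A * B := inv_one_sub_eq A (isUnit_one_sub hw hA hρ)
  rcases isEmpty_or_nonempty n with hn | hn
  · exact fun i => (IsEmpty.false i).elim
  obtain ⟨i₀, hi₀⟩ := Finite.exists_max fun i => wrs κ d B i
  have hW : wrs κ d B i₀ ≤ 1 + ρ * wrs κ d B i₀ := by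
    calc wrs κ d B i₀ = wrs κ d (1 + A * B) i₀ := by rw [← hfix]
      _ ≤ wrs κ d (1 : Matrix n n 𝕜) i₀ + wrs κ d (A * B) i₀ := wrs_add_le _ _ _
      _ ≤ 1 + ∑ l, ‖A i₀ l‖ * Real.exp (κ * d i₀ l) * wrs κ d B l := by
          rw [wrs_one hw]; exact add_le_add le_rfl (wrs_mul_le hw A B i₀)
      _ ≤ 1 + ∑ l, ‖A i₀ l‖ * Real.exp (κ * d i₀ l) * wrs κ d B i₀ :=
          add_le_add le_rfl (Finset.sum_le_sum fun l _ =>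
            mul_le_mul_of_nonneg_left (hi₀ l) (mul_nonneg (norm_nonneg _) (Real.exp_pos _).le))
      _ = 1 + wrs κ d A i₀ * wrs κ d B i₀ := by
          congr 1
          exact (Finset.sum_mul _ _ _).symm
      _ ≤ 1 + ρ * wrs κ d B i₀ := add_le_add le_rfl (mul_le_mul_of_nonneg_right (hA i₀) (wrs_nonneg B i₀))
  have hW' : wrs κ d B i₀ ≤ (1 - ρ)⁻¹ := by
    rw [inv_eq_one_div, le_div_iff₀ (sub_pos.2 hρ)]
    nlinarith
  exact fun i => (hi₀ i).trans hW'

/-- `WRS ((1 − A)⁻¹ − 1) (ρ(1 − ρ)⁻¹)`: the Neumann inverse differs from `1` by a (2.16)-type operator with constant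
`O(ρ)`. [folklore] -/
theorem WRS.inv_one_sub_sub_one (hw : WeightHyp κ d) {A : Matrix n n 𝕜} {ρ : ℝ} (hA : WRS κ d A ρ)
    (hρ : ρ < 1) : WRS κ d ((1 - A)⁻¹ - 1) (ρ * (1 - ρ)⁻¹) := by
  have hfix := inv_one_sub_eq A (isUnit_one_sub hw hA hρ)
  rw [sub_eq_of_eq_add (hfix.trans (add_comm _ _))]
  exact hA.mul hw (hA.inv_one_sub hw hρ)

/-- `WRS (1 + A)⁻¹ (1 − ρ)⁻¹`. [folklore] -/
theorem WRS.inv_one_add (hw : WeightHyp κ d) {A : Matrix n n 𝕜} {ρ : ℝ} (hA : WRS κ d A ρ) (hρ : ρ < 1) :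
    WRS κ d (1 + A)⁻¹ (1 - ρ)⁻¹ := by
  simpa [sub_neg_eq_add] using hA.neg.inv_one_sub hw hρ

/-- `WRS ((1 + A)⁻¹ − 1) (ρ(1 − ρ)⁻¹)`. [folklore] -/
theorem WRS.inv_one_add_sub_one (hw : WeightHyp κ d) {A : Matrix n n 𝕜} {ρ : ℝ} (hA : WRS κ d A ρ)
    (hρ : ρ < 1) : WRS κ d ((1 + A)⁻¹ - 1) (ρ * (1 - ρ)⁻¹) := by
  simpa [sub_neg_eq_add] using hA.neg.inv_one_sub_sub_one hw hρ

/-- Factorisation of a perturbed invertible matrix: `M₀ + R = M₀(1 + M₀⁻¹R)`. [folklore] -/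
theorem add_eq_mul_one_add (M₀ R : Matrix n n 𝕜) (hM : IsUnit M₀) : M₀ + R = M₀ * (1 + M₀⁻¹ * R) := by
  rw [mul_add, mul_one, ← mul_assoc, Matrix.mul_nonsing_inv M₀ ((Matrix.isUnit_iff_isUnit_det _).1 hM), one_mul]

/-- **A (2.16)-small perturbation of an invertible localised operator is invertible**: `WRS M₀⁻¹ K`, `WRS R θ`,
`Kθ < 1` ⇒ `M₀ + R` invertible. [folklore] -/
theorem isUnit_add (hw : WeightHyp κ d) {M₀ R : Matrix n n 𝕜} {K θ : ℝ} (hM : IsUnit M₀)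
    (hK : WRS κ d M₀⁻¹ K) (hR : WRS κ d R θ) (hKθ : K * θ < 1) : IsUnit (M₀ + R) := by
  rw [add_eq_mul_one_add M₀ R hM]
  exact hM.mul (isUnit_one_add hw (hK.mul hw hR) hKθ)

/-- `(M₀ + R)⁻¹ = (1 + M₀⁻¹R)⁻¹M₀⁻¹`. [folklore] -/
theorem inv_add_eq (M₀ R : Matrix n n 𝕜) (hM : IsUnit M₀) : (M₀ + R)⁻¹ = (1 + M₀⁻¹ * R)⁻¹ * M₀⁻¹ := by
  rw [add_eq_mul_one_add M₀ R hM, Matrix.mul_inv_rev]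

/-- **The perturbed inverse is localised**: `WRS (M₀ + R)⁻¹ ((1 − Kθ)⁻¹K)`. [folklore] -/
theorem WRS.inv_add (hw : WeightHyp κ d) {M₀ R : Matrix n n 𝕜} {K θ : ℝ} (hM : IsUnit M₀)
    (hK : WRS κ d M₀⁻¹ K) (hR : WRS κ d R θ) (hKθ : K * θ < 1) :
    WRS κ d (M₀ + R)⁻¹ ((1 - K * θ)⁻¹ * K) := by
  rw [inv_add_eq M₀ R hM]
  exact ((hK.mul hw hR).inv_one_add hw hKθ).mul hw hK

/-- **«R₂, R₃ satisfy (2.16) also» — the difference of the inverses inherits the (2.16)-type bound**: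
`WRS M₀⁻¹ K`, `WRS R θ`, `Kθ < 1` ⇒ `WRS ((M₀ + R)⁻¹ − M₀⁻¹) (Kθ(1 − Kθ)⁻¹K)`.
[cite: Balaban1988RG2Cluster, (2.16) p.16] -/
theorem WRS.inv_add_sub_inv (hw : WeightHyp κ d) {M₀ R : Matrix n n 𝕜} {K θ : ℝ} (hM : IsUnit M₀)
    (hK : WRS κ d M₀⁻¹ K) (hR : WRS κ d R θ) (hKθ : K * θ < 1) :
    WRS κ d ((M₀ + R)⁻¹ - M₀⁻¹) (K * θ * (1 - K * θ)⁻¹ * K) := by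
  have h : (M₀ + R)⁻¹ - M₀⁻¹ = ((1 + M₀⁻¹ * R)⁻¹ - 1) * M₀⁻¹ := by rw [inv_add_eq M₀ R hM, sub_mul, one_mul]
  rw [h]
  exact ((hK.mul hw hR).inv_one_add_sub_one hw hKθ).mul hw hK

/-- The same, ENTRYWISE in the printed shape of (2.16): `‖((M₀ + R)⁻¹ − M₀⁻¹) i j‖ ≤ Kθ(1 − Kθ)⁻¹K·e^{−κ d(i,j)}`.
[cite: Balaban1988RG2Cluster, (2.16) p.16] -/
theorem norm_inv_add_sub_inv_apply_le (hw : WeightHyp κ d) {M₀ R : Matrix n n 𝕜} {K θ : ℝ} (hM : IsUnit M₀)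
    (hK : WRS κ d M₀⁻¹ K) (hR : WRS κ d R θ) (hKθ : K * θ < 1) (i j : n) :
    ‖((M₀ + R)⁻¹ - M₀⁻¹) i j‖ ≤ K * θ * (1 - K * θ)⁻¹ * K * Real.exp (-(κ * d i j)) :=
  (WRS.inv_add_sub_inv hw hM hK hR hKθ).norm_apply_le i j

/-! ## §4. (2.17): determinants of perturbed operators by the Leibniz row-sum bound -/

/-- **Leibniz bound, columns**: `‖det M‖ ≤ Π_j Σ_i ‖M i j‖` (expand over permutations, bound by the sum over all
maps). [folklore] -/
theorem norm_det_le_prod_colSum (M : Matrix n n 𝕜) : ‖M.det‖ ≤ ∏ j, ∑ i, ‖M i j‖ := by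
  have hF : ∀ g : n → n, 0 ≤ ∏ j, ‖M (g j) j‖ := fun g => Finset.prod_nonneg fun j _ => norm_nonneg _
  have h1 : ‖M.det‖ ≤ ∑ σ : Equiv.Perm n, ∏ j, ‖M (σ j) j‖ := by
    rw [Matrix.det_apply']
    refine (norm_sum_le _ _).trans (le_of_eq (Finset.sum_congr rfl fun σ _ => ?_))
    have hs : ‖((Equiv.Perm.sign σ : ℤ) : 𝕜)‖ = 1 := by
      rcases Int.units_eq_one_or (Equiv.Perm.sign σ) with h | h <;> simp [h]
    rw [norm_mul, hs, one_mul, norm_prod]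
  have h2 : ∑ σ : Equiv.Perm n, ∏ j, ‖M (σ j) j‖ ≤ ∑ g : n → n, ∏ j, ‖M (g j) j‖ := by
    have hmap := Finset.sum_map Finset.univ ⟨fun σ : Equiv.Perm n => (σ : n → n), Equiv.coe_fn_injective⟩
      (fun g : n → n => ∏ j, ‖M (g j) j‖)
    simp only [Function.Embedding.coeFn_mk] at hmap
    rw [← hmap]
    exact Finset.sum_le_sum_of_subset_of_nonneg (Finset.subset_univ _) fun g _ _ => hF g
  have h3 : ∏ j, ∑ i, ‖M i j‖ = ∑ g : n → n, ∏ j, ‖M (g j) j‖ :=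
    Fintype.prod_sum (fun (j : n) (i : n) => ‖M i j‖)
  exact h1.trans (h2.trans h3.symm.le)

/-- **Leibniz bound, rows**: `‖det M‖ ≤ Π_i Σ_j ‖M i j‖`. [folklore] -/
theorem norm_det_le_prod_rowSum (M : Matrix n n 𝕜) : ‖M.det‖ ≤ ∏ i, ∑ j, ‖M i j‖ := by
  simpa only [Matrix.det_transpose, Matrix.transpose_apply] using norm_det_le_prod_colSum Mᵀ

/-- `‖det(1 + A)‖ ≤ exp(Σ_{ij} ‖A i j‖)` (rows `≤ 1 + r_i ≤ e^{r_i}`). [folklore] -/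
theorem norm_det_one_add_le_exp (A : Matrix n n 𝕜) : ‖(1 + A).det‖ ≤ Real.exp (∑ i, ∑ j, ‖A i j‖) := by
  have hrow : ∀ i, ∑ j, ‖(1 + A) i j‖ ≤ 1 + ∑ j, ‖A i j‖ := fun i => by
    calc ∑ j, ‖(1 + A) i j‖ ≤ ∑ j, (‖(1 : Matrix n n 𝕜) i j‖ + ‖A i j‖) :=
          Finset.sum_le_sum fun j _ => by rw [Matrix.add_apply]; exact norm_add_le _ _
      _ = 1 + ∑ j, ‖A i j‖ := by
          rw [Finset.sum_add_distrib, Finset.sum_eq_single i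
            (fun j _ hji => by rw [Matrix.one_apply_ne' hji, norm_zero]) (fun h => (h (Finset.mem_univ i)).elim),
            Matrix.one_apply_eq, norm_one]
  calc ‖(1 + A).det‖ ≤ ∏ i, ∑ j, ‖(1 + A) i j‖ := norm_det_le_prod_rowSum _
    _ ≤ ∏ i, (1 + ∑ j, ‖A i j‖) :=
        Finset.prod_le_prod (fun i _ => Finset.sum_nonneg fun j _ => norm_nonneg _) fun i _ => hrow i
    _ ≤ ∏ i, Real.exp (∑ j, ‖A i j‖) :=
        Finset.prod_le_prod (fun i _ => by positivity) fun i _ => by rw [add_comm]; exact Real.add_one_le_exp _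
    _ = Real.exp (∑ i, ∑ j, ‖A i j‖) := (Real.exp_sum _ _).symm

omit [DecidableEq n] in
/-- The double sum of moduli is at most `#n · ρ` under `WRS A ρ`. [folklore] -/
theorem sum_sum_norm_le_card_mul (hw : WeightHyp κ d) {A : Matrix n n 𝕜} {ρ : ℝ} (hA : WRS κ d A ρ) :
    ∑ i, ∑ j, ‖A i j‖ ≤ Fintype.card n * ρ := by
  calc ∑ i, ∑ j, ‖A i j‖ ≤ ∑ i, ρ := Finset.sum_le_sum fun i _ => (rowSum_le_wrs hw A i).trans (hA i)
    _ = Fintype.card n * ρ := by rw [Finset.sum_const, Finset.card_univ, nsmul_eq_mul]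

/-- `‖det(1 + A)‖ ≤ exp(#n · ρ)` under `WRS A ρ`. [folklore] -/
theorem norm_det_one_add_le_exp_card (hw : WeightHyp κ d) {A : Matrix n n 𝕜} {ρ : ℝ} (hA : WRS κ d A ρ) :
    ‖(1 + A).det‖ ≤ Real.exp (Fintype.card n * ρ) :=
  (norm_det_one_add_le_exp A).trans (Real.exp_le_exp.2 (sum_sum_norm_le_card_mul hw hA))

/-- **(2.17), upper half**: `‖det(M₀ + R)‖ ≤ ‖det M₀‖·exp(#n·Kθ)` for `WRS M₀⁻¹ K`, `WRS R θ`.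
[cite: Balaban1988RG2Cluster, (2.17) p.16] -/
theorem norm_det_add_le (hw : WeightHyp κ d) {M₀ R : Matrix n n 𝕜} {K θ : ℝ} (hM : IsUnit M₀)
    (hK : WRS κ d M₀⁻¹ K) (hR : WRS κ d R θ) :
    ‖(M₀ + R).det‖ ≤ ‖M₀.det‖ * Real.exp (Fintype.card n * (K * θ)) := by
  rw [add_eq_mul_one_add M₀ R hM, Matrix.det_mul, norm_mul]
  exact mul_le_mul_of_nonneg_left (norm_det_one_add_le_exp_card hw (hK.mul hw hR)) (norm_nonneg _)

/-- **(2.17), lower half**: `‖det M₀‖ ≤ ‖det(M₀ + R)‖·exp(#n·Kθ(1 − Kθ)⁻¹)` for `WRS M₀⁻¹ K`, `WRS R θ`, `Kθ < 1`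
(apply the upper half to `(1 + M₀⁻¹R)⁻¹ = 1 + ((1 + M₀⁻¹R)⁻¹ − 1)`). [cite: Balaban1988RG2Cluster, (2.17) p.16] -/
theorem norm_det_le_norm_det_add (hw : WeightHyp κ d) {M₀ R : Matrix n n 𝕜} {K θ : ℝ} (hM : IsUnit M₀)
    (hK : WRS κ d M₀⁻¹ K) (hR : WRS κ d R θ) (hKθ : K * θ < 1) :
    ‖M₀.det‖ ≤ ‖(M₀ + R).det‖ * Real.exp (Fintype.card n * (K * θ * (1 - K * θ)⁻¹)) := by
  have hP : WRS κ d (M₀⁻¹ * R) (K * θ) := hK.mul hw hR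
  have hPdet : IsUnit (1 + M₀⁻¹ * R).det := (Matrix.isUnit_iff_isUnit_det _).1 (isUnit_one_add hw hP hKθ)
  have hM₀ : M₀ = (M₀ + R) * (1 + M₀⁻¹ * R)⁻¹ := by
    rw [add_eq_mul_one_add M₀ R hM]
    exact (Matrix.mul_nonsing_inv_cancel_right (1 + M₀⁻¹ * R) M₀ hPdet).symm
  have h1 : (1 + M₀⁻¹ * R)⁻¹ = 1 + ((1 + M₀⁻¹ * R)⁻¹ - 1) := by abel
  calc ‖M₀.det‖ = ‖(M₀ + R).det‖ * ‖((1 + M₀⁻¹ * R)⁻¹).det‖ := by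
        conv_lhs => rw [hM₀]
        rw [Matrix.det_mul, norm_mul]
    _ ≤ ‖(M₀ + R).det‖ * Real.exp (Fintype.card n * (K * θ * (1 - K * θ)⁻¹)) := by
        refine mul_le_mul_of_nonneg_left ?_ (norm_nonneg _)
        rw [h1]
        exact norm_det_one_add_le_exp_card hw (hP.inv_one_add_sub_one hw hKθ)

/-- **(2.17), two-sided quotient form**: `e^{−#n·Kθ/(1−Kθ)} ≤ ‖det(M₀ + R)‖/‖det M₀‖ ≤ e^{#n·Kθ}`.
[cite: Balaban1988RG2Cluster, (2.17) p.16] -/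
theorem det_ratio_bounds (hw : WeightHyp κ d) {M₀ R : Matrix n n 𝕜} {K θ : ℝ} (hM : IsUnit M₀)
    (hK : WRS κ d M₀⁻¹ K) (hR : WRS κ d R θ) (hKθ : K * θ < 1) :
    Real.exp (-(Fintype.card n * (K * θ * (1 - K * θ)⁻¹))) ≤ ‖(M₀ + R).det‖ / ‖M₀.det‖ ∧
      ‖(M₀ + R).det‖ / ‖M₀.det‖ ≤ Real.exp (Fintype.card n * (K * θ)) := by
  have h0 : 0 < ‖M₀.det‖ := norm_pos_iff.2 ((Matrix.isUnit_iff_isUnit_det _).1 hM).ne_zero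
  constructor
  · rw [le_div_iff₀ h0]
    calc Real.exp (-(Fintype.card n * (K * θ * (1 - K * θ)⁻¹))) * ‖M₀.det‖
        ≤ Real.exp (-(Fintype.card n * (K * θ * (1 - K * θ)⁻¹))) *
            (‖(M₀ + R).det‖ * Real.exp (Fintype.card n * (K * θ * (1 - K * θ)⁻¹))) :=
          mul_le_mul_of_nonneg_left (norm_det_le_norm_det_add hw hM hK hR hKθ) (Real.exp_pos _).le
      _ = ‖(M₀ + R).det‖ := by
          rw [Real.exp_neg]
          field_simp
  · rw [div_le_iff₀ h0, mul_comm]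
    exact norm_det_add_le hw hM hK hR

/-- **(2.17) as printed, with the square root**: `(‖det(M₀ + R)‖/‖det M₀‖)^{1/2} ≤ exp(½·#n·Kθ)`.
[cite: Balaban1988RG2Cluster, (2.17) p.16] -/
theorem sqrt_det_ratio_le (hw : WeightHyp κ d) {M₀ R : Matrix n n 𝕜} {K θ : ℝ} (hM : IsUnit M₀)
    (hK : WRS κ d M₀⁻¹ K) (hR : WRS κ d R θ) (hKθ : K * θ < 1) :
    Real.sqrt (‖(M₀ + R).det‖ / ‖M₀.det‖) ≤ Real.exp (Fintype.card n * (K * θ) / 2) := by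
  rw [Real.exp_half]
  exact Real.sqrt_le_sqrt (det_ratio_bounds hw hM hK hR hKθ).2

/-! ## §5. (2.21): a bilinear form with localised kernel is bounded by `½θ(‖v‖² + ‖w‖²)` (Schur / AM–GM) -/

omit [DecidableEq n] in
/-- **(2.21)**: `‖Σ_{ij} v_i R_{ij} w_j‖ ≤ ½(r·Σ_i ‖v_i‖² + c·Σ_j ‖w_j‖²)` when the row sums of `‖R‖` are `≤ r` and
the column sums `≤ c`. [cite: Balaban1988RG2Cluster, (2.21) p.16] -/
theorem norm_bilinForm_le (R : Matrix n n 𝕜) (v w : n → 𝕜) {r c : ℝ} (hr : ∀ i, ∑ j, ‖R i j‖ ≤ r)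
    (hc : ∀ j, ∑ i, ‖R i j‖ ≤ c) :
    ‖∑ i, ∑ j, v i * R i j * w j‖ ≤ 1 / 2 * (r * ∑ i, ‖v i‖ ^ 2 + c * ∑ j, ‖w j‖ ^ 2) := by
  calc ‖∑ i, ∑ j, v i * R i j * w j‖ ≤ ∑ i, ∑ j, ‖R i j‖ * (‖v i‖ * ‖w j‖) := by
        refine (norm_sum_le _ _).trans (Finset.sum_le_sum fun i _ =>
          (norm_sum_le _ _).trans (Finset.sum_le_sum fun j _ => ?_))
        rw [norm_mul, norm_mul]
        exact le_of_eq (by ring)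
    _ ≤ ∑ i, ∑ j, ‖R i j‖ * ((‖v i‖ ^ 2 + ‖w j‖ ^ 2) / 2) :=
        Finset.sum_le_sum fun i _ => Finset.sum_le_sum fun j _ =>
          mul_le_mul_of_nonneg_left (by nlinarith [two_mul_le_add_sq ‖v i‖ ‖w j‖]) (norm_nonneg _)
    _ = 1 / 2 * ∑ i, ‖v i‖ ^ 2 * ∑ j, ‖R i j‖ + 1 / 2 * ∑ j, ‖w j‖ ^ 2 * ∑ i, ‖R i j‖ := by
        have hsplit : ∀ i j, ‖R i j‖ * ((‖v i‖ ^ 2 + ‖w j‖ ^ 2) / 2)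
            = 1 / 2 * (‖v i‖ ^ 2 * ‖R i j‖) + 1 / 2 * (‖w j‖ ^ 2 * ‖R i j‖) := fun i j => by ring
        simp_rw [hsplit, Finset.sum_add_distrib, ← Finset.mul_sum]
        rw [Finset.sum_comm (f := fun i j => ‖w j‖ ^ 2 * ‖R i j‖)]
        simp_rw [← Finset.mul_sum]
    _ ≤ 1 / 2 * (r * ∑ i, ‖v i‖ ^ 2 + c * ∑ j, ‖w j‖ ^ 2) := by
        rw [mul_add]
        refine add_le_add (mul_le_mul_of_nonneg_left ?_ (by norm_num))
          (mul_le_mul_of_nonneg_left ?_ (by norm_num))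
        · calc ∑ i, ‖v i‖ ^ 2 * ∑ j, ‖R i j‖ ≤ ∑ i, ‖v i‖ ^ 2 * r :=
              Finset.sum_le_sum fun i _ => mul_le_mul_of_nonneg_left (hr i) (by positivity)
            _ = r * ∑ i, ‖v i‖ ^ 2 := by rw [← Finset.sum_mul, mul_comm]
        · calc ∑ j, ‖w j‖ ^ 2 * ∑ i, ‖R i j‖ ≤ ∑ j, ‖w j‖ ^ 2 * c :=
              Finset.sum_le_sum fun j _ => mul_le_mul_of_nonneg_left (hc j) (by positivity)
            _ = c * ∑ j, ‖w j‖ ^ 2 := by rw [← Finset.sum_mul, mul_comm]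

omit [DecidableEq n] in
/-- (2.21) from `WRS` bounds on `R` and on its transpose (the printed bound (2.16) is symmetric in `b, b′`):
`‖Σ v_i R_{ij} w_j‖ ≤ ½θ(Σ‖v_i‖² + Σ‖w_j‖²)`. [cite: Balaban1988RG2Cluster, (2.21) p.16] -/
theorem norm_bilinForm_le_of_WRS (hw : WeightHyp κ d) {R : Matrix n n 𝕜} {θ : ℝ} (hR : WRS κ d R θ)
    (hRt : WRS κ d Rᵀ θ) (v w : n → 𝕜) :
    ‖∑ i, ∑ j, v i * R i j * w j‖ ≤ 1 / 2 * θ * (∑ i, ‖v i‖ ^ 2 + ∑ j, ‖w j‖ ^ 2) := by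
  have h := norm_bilinForm_le R v w (fun i => (rowSum_le_wrs hw R i).trans (hR i))
    (fun j => by simpa only [Matrix.transpose_apply] using (rowSum_le_wrs hw Rᵀ j).trans (hRt j))
  simpa only [mul_add, mul_assoc] using h

end wrs

/-! ## §6. (2.24)–(2.25): the symmetric case `σ(Z) = 0`, `J = 0`
(the scalar inequality `e^{−2t} ≤ 1 − t` on `[0, ½]` — `1 + 2t ≤ e^{2t}` and `(1 + 2t)(1 − t) ≥ 1` — is re-derived
inline from Mathlib's `Real.add_one_le_exp` at its two use sites; v1–v1.1 named the tree's
`Literature.NumberTheory.LFunctions.Nicolas.exp_neg_two_mul_le` for it, an import dropped in v1.2) -/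

section symmetric

variable {n : Type*} [Fintype n] [DecidableEq n]

/-- `det(1 − αC) = Π_k (1 − αλ_k)` for a real symmetric `C` with eigenvalues `λ_k` (spectral theorem).
[folklore] -/
theorem det_one_sub_smul_eq_prod {C : Matrix n n ℝ} (hC : C.IsHermitian) (α : ℝ) :
    (1 - α • C).det = ∏ k, (1 - α * hC.eigenvalues k) := by
  set U : Matrix n n ℝ := (hC.eigenvectorUnitary : Matrix n n ℝ) with hU
  set D : Matrix n n ℝ := diagonal (RCLike.ofReal ∘ hC.eigenvalues) with hD
  have hUU : U * star U = 1 := Unitary.coe_mul_star_self hC.eigenvectorUnitary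
  have hspec : C = U * D * star U := by
    have h := hC.spectral_theorem
    rwa [Unitary.conjStarAlgAut_apply] at h
  have h1 : 1 - α • C = U * (1 - α • D) * star U := by
    rw [hspec, mul_sub, sub_mul, mul_one, hUU, Matrix.mul_smul, Matrix.smul_mul]
  have hdetU : U.det * (star U).det = 1 := by rw [← Matrix.det_mul, hUU, Matrix.det_one]
  have h2 : 1 - α • D = diagonal (fun k => 1 - α * hC.eigenvalues k) := by
    ext i j
    simp only [hD, Matrix.sub_apply, Matrix.smul_apply, Matrix.one_apply, diagonal_apply, Function.comp_apply,
      RCLike.ofReal_real_eq_id, id, smul_eq_mul]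
    split_ifs <;> simp
  rw [h1, Matrix.det_mul, Matrix.det_mul,
    show U.det * (1 - α • D).det * (star U).det = (1 - α • D).det * (U.det * (star U).det) by ring, hdetU,
    mul_one, h2, det_diagonal]

/-- `C⁻¹ − αI = C⁻¹(1 − αC)` for invertible `C`. [folklore] -/
theorem inv_sub_smul_one_eq {C : Matrix n n ℝ} (hC : IsUnit C.det) (α : ℝ) :
    C⁻¹ - α • (1 : Matrix n n ℝ) = C⁻¹ * (1 - α • C) := by
  rw [mul_sub, mul_one, Matrix.mul_smul, Matrix.nonsing_inv_mul _ hC]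

/-- `(C⁻¹ − αI)⁻¹ = (1 − αC)⁻¹C`: the covariance of (2.24) is `C` corrected by `(1 − αC)⁻¹ − 1 = αC(1 − αC)⁻¹`.
[cite: Balaban1988RG2Cluster, (2.24) p.17] -/
theorem inv_inv_sub_smul_eq {C : Matrix n n ℝ} (hC : IsUnit C.det) (α : ℝ) :
    (C⁻¹ - α • (1 : Matrix n n ℝ))⁻¹ = (1 - α • C)⁻¹ * C := by
  rw [inv_sub_smul_one_eq hC, Matrix.mul_inv_rev, Matrix.nonsing_inv_nonsing_inv _ hC]

/-- **(2.24), the determinant quotient, exactly**: `det C⁻¹/det(C⁻¹ − αI) = (Π_k (1 − αλ_k))⁻¹` for a real positive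
definite `C` (if some `αλ_k = 1` both sides are the junk value `0`). [cite: Balaban1988RG2Cluster, (2.24) p.17] -/
theorem det_ratio_eq_prod_inv {C : Matrix n n ℝ} (hC : C.PosDef) (α : ℝ) :
    C⁻¹.det / (C⁻¹ - α • (1 : Matrix n n ℝ)).det = (∏ k, (1 - α * hC.1.eigenvalues k))⁻¹ := by
  have hdet : IsUnit C.det := hC.det_pos.ne'.isUnit
  have hinv : C⁻¹.det ≠ 0 := by
    intro h0
    have h1 := Matrix.det_nonsing_inv_mul_det C hdet
    rw [h0, zero_mul] at h1
    exact zero_ne_one h1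
  rw [inv_sub_smul_one_eq hdet, Matrix.det_mul, det_one_sub_smul_eq_prod hC.1 α, div_mul_cancel_left₀ hinv]

/-- **(2.24), "the factor with the determinants can be estimated by exp O(1)α₅|Z₀|"**: for a real positive definite
`C` with eigenvalues `λ_k`, `α ≥ 0`, `αλ_k ≤ ½`: `1 ≤ det C⁻¹/det(C⁻¹ − αI) ≤ exp(2α Σ_k λ_k)`.
[cite: Balaban1988RG2Cluster, (2.24) p.17] -/
theorem det_ratio_mem_Icc {C : Matrix n n ℝ} (hC : C.PosDef) {α : ℝ} (hα0 : 0 ≤ α)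
    (hα : ∀ k, α * hC.1.eigenvalues k ≤ 1 / 2) :
    1 ≤ C⁻¹.det / (C⁻¹ - α • (1 : Matrix n n ℝ)).det ∧
      C⁻¹.det / (C⁻¹ - α • (1 : Matrix n n ℝ)).det ≤ Real.exp (2 * α * ∑ k, hC.1.eigenvalues k) := by
  have hpos : ∀ k, 0 < hC.1.eigenvalues k := hC.eigenvalues_pos
  rw [det_ratio_eq_prod_inv hC α]
  have hf0 : ∀ k, 0 < 1 - α * hC.1.eigenvalues k := fun k => by linarith [hα k]
  have hf1 : ∀ k, 1 - α * hC.1.eigenvalues k ≤ 1 := fun k => by nlinarith [hpos k]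
  refine ⟨(one_le_inv₀ (Finset.prod_pos fun k _ => hf0 k)).2
    (Finset.prod_le_one (fun k _ => (hf0 k).le) fun k _ => hf1 k), ?_⟩
  have hsum : -(2 * α * ∑ k, hC.1.eigenvalues k) = ∑ k, -(2 * (α * hC.1.eigenvalues k)) := by
    rw [Finset.mul_sum, ← Finset.sum_neg_distrib]
    exact Finset.sum_congr rfl fun k _ => by ring
  -- `e^{−2t} ≤ 1 − t` for `0 ≤ t ≤ ½`: `1 + 2t ≤ e^{2t}` (Mathlib `Real.add_one_le_exp`) and `(1 + 2t)(1 − t) ≥ 1`.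
  have hexp : ∀ t : ℝ, 0 ≤ t → t ≤ 1 / 2 → Real.exp (-(2 * t)) ≤ 1 - t := fun t ht0 ht => by
    have he : 2 * t + 1 ≤ Real.exp (2 * t) := Real.add_one_le_exp _
    rw [Real.exp_neg, inv_le_iff_one_le_mul₀ (Real.exp_pos _)]
    nlinarith [mul_nonneg ht0 (show 0 ≤ 1 - 2 * t by linarith)]
  have h : Real.exp (-(2 * α * ∑ k, hC.1.eigenvalues k)) ≤ ∏ k, (1 - α * hC.1.eigenvalues k) := by
    rw [hsum, Real.exp_sum]
    exact Finset.prod_le_prod (fun k _ => (Real.exp_pos _).le) fun k _ =>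
      hexp _ (mul_nonneg hα0 (hpos k).le) (hα k)
  calc (∏ k, (1 - α * hC.1.eigenvalues k))⁻¹ ≤ (Real.exp (-(2 * α * ∑ k, hC.1.eigenvalues k)))⁻¹ :=
        inv_anti₀ (Real.exp_pos _) h
    _ = Real.exp (2 * α * ∑ k, hC.1.eigenvalues k) := by rw [Real.exp_neg, inv_inv]

/-- **(2.24) with the constant explicit**: if moreover `λ_k ≤ c` (`c = ‖C^{(k)}(Z₀,0)‖`) and `αc ≤ ½`, then
`1 ≤ det C⁻¹/det(C⁻¹ − αI) ≤ exp(2αc·#n)` — after the square root, `exp(α‖C‖·#n) = exp(O(1)α₅|Z₀|)`.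
[cite: Balaban1988RG2Cluster, (2.24) p.17] -/
theorem det_ratio_le_exp_card {C : Matrix n n ℝ} (hC : C.PosDef) {α c : ℝ} (hα0 : 0 ≤ α)
    (hc : ∀ k, hC.1.eigenvalues k ≤ c) (hαc : α * c ≤ 1 / 2) :
    1 ≤ C⁻¹.det / (C⁻¹ - α • (1 : Matrix n n ℝ)).det ∧
      C⁻¹.det / (C⁻¹ - α • (1 : Matrix n n ℝ)).det ≤ Real.exp (2 * α * c * Fintype.card n) := by
  have hα : ∀ k, α * hC.1.eigenvalues k ≤ 1 / 2 := fun k => (mul_le_mul_of_nonneg_left (hc k) hα0).trans hαc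
  refine ⟨(det_ratio_mem_Icc hC hα0 hα).1, (det_ratio_mem_Icc hC hα0 hα).2.trans (Real.exp_le_exp.2 ?_)⟩
  calc 2 * α * ∑ k, hC.1.eigenvalues k ≤ 2 * α * ∑ _k : n, c :=
        mul_le_mul_of_nonneg_left (Finset.sum_le_sum fun k _ => hc k) (by positivity)
    _ = 2 * α * c * Fintype.card n := by rw [Finset.sum_const, Finset.card_univ, nsmul_eq_mul]; ring

/-- The scalar remainder inequality behind "the remainder can be estimated by ½O(α₅)‖ZX‖²": on the spectrum,
`λ(1 − αλ)⁻¹ − λ = αλ²(1 − αλ)⁻¹ ≤ 2αλ²` for `α ≥ 0`, `αλ ≤ ½` (so the remainder form is `≤ 2α‖C‖²‖v‖²`).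
[folklore] -/
theorem remainder_scalar_le {α t : ℝ} (hα : 0 ≤ α) (h : α * t ≤ 1 / 2) :
    0 ≤ t * (1 - α * t)⁻¹ - t ∧ t * (1 - α * t)⁻¹ - t ≤ 2 * α * t ^ 2 := by
  have h1 : 0 < 1 - α * t := by linarith
  have h1' : 1 - α * t ≠ 0 := h1.ne'
  have heq : t * (1 - α * t)⁻¹ - t = α * t ^ 2 / (1 - α * t) := by
    rw [eq_div_iff h1', sub_mul, mul_assoc, inv_mul_cancel₀ h1', mul_one]
    ring
  rw [heq]
  refine ⟨div_nonneg (by positivity) h1.le, ?_⟩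
  rw [div_le_iff₀ h1]
  nlinarith [mul_nonneg hα (sq_nonneg t)]

/-- **(2.25), one coordinate**: `(2π)^{−1/2} ∫ e^{−x²/2} e^{ax²/2} dx = (1 − a)^{−1/2}` for `a < 1`.
[cite: Balaban1988RG2Cluster, (2.25) p.17] -/
theorem gaussian_exp_sq_integral {a : ℝ} (ha : a < 1) :
    (∫ x : ℝ, Real.exp (-(1 / 2) * x ^ 2) * Real.exp (a / 2 * x ^ 2)) / Real.sqrt (2 * π)
      = (Real.sqrt (1 - a))⁻¹ := by
  have h1 : (0 : ℝ) < 1 - a := by linarith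
  have hfun : ∀ x : ℝ, Real.exp (-(1 / 2) * x ^ 2) * Real.exp (a / 2 * x ^ 2)
      = Real.exp (-((1 - a) / 2) * x ^ 2) := fun x => by
    rw [← Real.exp_add]; ring_nf
  simp_rw [hfun, integral_gaussian]
  have hπ : 0 < Real.sqrt π := Real.sqrt_pos.2 Real.pi_pos
  have h2 : 0 < Real.sqrt 2 := Real.sqrt_pos.2 (by norm_num)
  have h3 : 0 < Real.sqrt (1 - a) := Real.sqrt_pos.2 h1
  rw [Real.sqrt_div' _ (by positivity : (0 : ℝ) ≤ (1 - a) / 2), Real.sqrt_div' _ (by norm_num : (0 : ℝ) ≤ 2),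
    Real.sqrt_mul' _ Real.pi_pos.le]
  field_simp

/-- **(2.25), the product over `Z`**: `√(((1 − a)⁻¹)^N) ≤ e^{aN}` for `0 ≤ a ≤ ½` — with `N = d(𝔤)|Z|` coordinates,
`Π_{b∈Z}(1 − a)^{−d(𝔤)/2} ≤ exp(a·d(𝔤)|Z|) = exp(O(α₅)|Z|)`. [cite: Balaban1988RG2Cluster, (2.25) p.17] -/
theorem sqrt_inv_one_sub_pow_le {a : ℝ} (h0 : 0 ≤ a) (h1 : a ≤ 1 / 2) (N : ℕ) :
    Real.sqrt (((1 - a)⁻¹) ^ N) ≤ Real.exp (a * N) := by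
  have hpos : 0 < 1 - a := by linarith
  have hstep : (1 - a)⁻¹ ≤ Real.exp (2 * a) := by
    -- `e^{−2a} ≤ 1 − a`: `1 + 2a ≤ e^{2a}` (Mathlib `Real.add_one_le_exp`) and `(1 + 2a)(1 − a) ≥ 1`.
    have h : Real.exp (-(2 * a)) ≤ 1 - a := by
      have he : 2 * a + 1 ≤ Real.exp (2 * a) := Real.add_one_le_exp _
      rw [Real.exp_neg, inv_le_iff_one_le_mul₀ (Real.exp_pos _)]
      nlinarith [mul_nonneg h0 (show 0 ≤ 1 - 2 * a by linarith)]
    calc (1 - a)⁻¹ ≤ (Real.exp (-(2 * a)))⁻¹ := inv_anti₀ (Real.exp_pos _) h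
      _ = Real.exp (2 * a) := by rw [Real.exp_neg, inv_inv]
  have hpow : ((1 - a)⁻¹) ^ N ≤ Real.exp (2 * (a * N)) := by
    calc ((1 - a)⁻¹) ^ N ≤ (Real.exp (2 * a)) ^ N :=
          pow_le_pow_left₀ (inv_nonneg.2 hpos.le) hstep N
      _ = Real.exp (2 * (a * N)) := by rw [← Real.exp_nat_mul]; ring_nf
  calc Real.sqrt (((1 - a)⁻¹) ^ N) ≤ Real.sqrt (Real.exp (2 * (a * N))) := Real.sqrt_le_sqrt hpow
    _ = Real.exp (a * N) := by
        rw [← Real.exp_half]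
        ring_nf

end symmetric

/-! ## §7. Complements: entrywise decay ⇒ weighted row sums at a smaller rate; the CAUCHY STEP of the leaf
(an analytic matrix family with a localised majorant has differences obeying a (2.16)-type bound, linear in the
parameter); the FORM version of the (2.24) remainder -/

section complements

open Metric

variable {𝕜 : Type*} [RCLike 𝕜] {n : Type*} [Fintype n] [DecidableEq n] {κ : ℝ} {d : n → n → ℝ}

omit [DecidableEq n] in
/-- A localised MAJORANT gives the (2.16)-type bound: `‖A i j‖ ≤ m i j` with `Σ_j m i j e^{κ d(i,j)} ≤ ρ` ⇒
`WRS κ d A ρ`. [folklore] -/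
theorem WRS.of_majorant {A : Matrix n n 𝕜} {m : n → n → ℝ} {ρ : ℝ} (hm : ∀ i j, ‖A i j‖ ≤ m i j)
    (hρ : ∀ i, ∑ j, m i j * Real.exp (κ * d i j) ≤ ρ) : WRS κ d A ρ := fun i =>
  (Finset.sum_le_sum fun j _ => mul_le_mul_of_nonneg_right (hm i j) (Real.exp_pos _).le).trans (hρ i)

omit [DecidableEq n] in
/-- **Entrywise decay ⇒ weighted row sums at any smaller rate**, at the price of a lattice constant: if
`‖A i j‖ ≤ θ e^{−κ d(i,j)}` and `Σ_j e^{−(κ−κ′) d(i,j)} ≤ L` for every row `i`, then `WRS κ′ d A (θL)` — the converse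
direction to `WRS.norm_apply_le`, i.e. the printed entrywise form of (2.16) implies the typed row-sum form at rate
`κ′ < κ` (in print `Σ_{b′} e^{−(κ−κ′)|b₋ − b′₋|} = O(1)` on the unit lattice). [folklore] -/
theorem WRS.of_entrywise {A : Matrix n n 𝕜} {θ κ' L : ℝ} (hθ : 0 ≤ θ)
    (hA : ∀ i j, ‖A i j‖ ≤ θ * Real.exp (-(κ * d i j)))
    (hL : ∀ i, ∑ j, Real.exp (-((κ - κ') * d i j)) ≤ L) : WRS κ' d A (θ * L) := by
  refine WRS.of_majorant (m := fun i j => θ * Real.exp (-(κ * d i j))) hA fun i => ?_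
  calc ∑ j, θ * Real.exp (-(κ * d i j)) * Real.exp (κ' * d i j)
      = θ * ∑ j, Real.exp (-((κ - κ') * d i j)) := by
        rw [Finset.mul_sum]
        refine Finset.sum_congr rfl fun j _ => ?_
        rw [mul_assoc, ← Real.exp_add]
        ring_nf
    _ ≤ θ * L := mul_le_mul_of_nonneg_left (hL i) hθ

/-- **The Cauchy step, scalar**: an analytic `f` on the disc `|z| < R` with `‖f‖ ≤ M` there satisfies
`‖f z − f 0‖ ≤ (2M/R)‖z‖` (Schwarz lemma applied to `f − f 0`, which maps the disc into the closed disc of radius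
`2M`). [folklore] -/
theorem norm_sub_apply_zero_le {f : ℂ → ℂ} {R M : ℝ} (hR : 0 < R) (hf : DifferentiableOn ℂ f (ball 0 R))
    (hM : ∀ z ∈ ball (0 : ℂ) R, ‖f z‖ ≤ M) {z : ℂ} (hz : z ∈ ball (0 : ℂ) R) :
    ‖f z - f 0‖ ≤ 2 * M / R * ‖z‖ := by
  have hmaps : Set.MapsTo f (ball 0 R) (closedBall (f 0) (2 * M)) := fun w hw => by
    rw [mem_closedBall, dist_eq_norm]
    calc ‖f w - f 0‖ ≤ ‖f w‖ + ‖f 0‖ := norm_sub_le _ _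
      _ ≤ M + M := add_le_add (hM w hw) (hM 0 (mem_ball_self hR))
      _ = 2 * M := by ring
  have h := Complex.dist_le_div_mul_dist_of_mapsTo_ball hf hmaps hz
  rwa [dist_eq_norm, dist_eq_norm, sub_zero] at h

omit [DecidableEq n] in
/-- **The Cauchy step of the leaf (2.16)**: a matrix family `σ ↦ A σ`, entrywise analytic on the disc `|σ| < R`
and dominated there by ONE localised majorant `m` (`‖A σ i j‖ ≤ m i j`, `Σ_j m i j e^{κ d(i,j)} ≤ ρ` — the
uniformly localised random-walk expansion of the analytically continued operators, cell GAPS G-B13-05a /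
G-IF-10, is exactly this hypothesis), has differences `A σ − A 0` obeying a (2.16)-type bound with constant
`(2ρ/R)·|σ|`, i.e. `O(|σ|)` at the full rate `κ`.  What remains of the leaf after this theorem is the analyticity
+ uniform localisation itself. [cite: Balaban1988RG2Cluster, (2.16) p.16] -/
theorem WRS.sub_apply_zero_of_differentiableOn {A : ℂ → Matrix n n ℂ} {m : n → n → ℝ} {R ρ : ℝ}
    (hR : 0 < R) (ha : ∀ i j, DifferentiableOn ℂ (fun σ => A σ i j) (ball 0 R))
    (hm : ∀ σ ∈ ball (0 : ℂ) R, ∀ i j, ‖A σ i j‖ ≤ m i j)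
    (hρ : ∀ i, ∑ j, m i j * Real.exp (κ * d i j) ≤ ρ) {σ : ℂ} (hσ : σ ∈ ball (0 : ℂ) R) :
    WRS κ d (A σ - A 0) (2 * ρ / R * ‖σ‖) := by
  have hent : ∀ i j, ‖(A σ - A 0) i j‖ ≤ 2 * m i j / R * ‖σ‖ := fun i j => by
    rw [Matrix.sub_apply]
    exact norm_sub_apply_zero_le hR (ha i j) (fun z hz => hm z hz i j) hσ
  refine WRS.of_majorant hent fun i => ?_
  have hR0 : 0 ≤ 2 / R * ‖σ‖ := by positivity
  calc ∑ j, 2 * m i j / R * ‖σ‖ * Real.exp (κ * d i j)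
      = 2 / R * ‖σ‖ * ∑ j, m i j * Real.exp (κ * d i j) := by
        rw [Finset.mul_sum]
        exact Finset.sum_congr rfl fun j _ => by ring
    _ ≤ 2 / R * ‖σ‖ * ρ := mul_le_mul_of_nonneg_left (hρ i) hR0
    _ = 2 * ρ / R * ‖σ‖ := by ring

/-- Combining the Cauchy step with §3: if moreover `A 0 = M₀` is invertible with `WRS κ d M₀⁻¹ K` and
`K·(2ρ/R)|σ| < 1`, then `(A σ)⁻¹ − M₀⁻¹` obeys a (2.16)-type bound with constant `Kθ(1 − Kθ)⁻¹K`,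
`θ = (2ρ/R)|σ|` — the shape of «R₂ satisfying (2.16)» with its `O(α₀ + α₁)`-smallness made explicit as
`O(|σ|/R)`. [cite: Balaban1988RG2Cluster, (2.16)–(2.17) p.16] -/
theorem WRS.inv_sub_inv_of_differentiableOn (hw : WeightHyp κ d) {A : ℂ → Matrix n n ℂ} {m : n → n → ℝ}
    {R ρ K : ℝ} (hR : 0 < R) (ha : ∀ i j, DifferentiableOn ℂ (fun σ => A σ i j) (ball 0 R))
    (hm : ∀ σ ∈ ball (0 : ℂ) R, ∀ i j, ‖A σ i j‖ ≤ m i j)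
    (hρ : ∀ i, ∑ j, m i j * Real.exp (κ * d i j) ≤ ρ) (hM : IsUnit (A 0)) (hK : WRS κ d (A 0)⁻¹ K)
    {σ : ℂ} (hσ : σ ∈ ball (0 : ℂ) R) (hsmall : K * (2 * ρ / R * ‖σ‖) < 1) :
    WRS κ d ((A σ)⁻¹ - (A 0)⁻¹)
      (K * (2 * ρ / R * ‖σ‖) * (1 - K * (2 * ρ / R * ‖σ‖))⁻¹ * K) := by
  have h := WRS.inv_add_sub_inv hw hM hK (WRS.sub_apply_zero_of_differentiableOn hR ha hm hρ hσ) hsmall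
  rwa [add_sub_cancel] at h

end complements

/-! ### The form version of the (2.24) remainder -/

section remainderForm

variable {n : Type*} [Fintype n] [DecidableEq n]

/-- The quadratic form of a conjugated diagonal real matrix: `⟨w, U·diag(f)·Uᵀ w⟩ = Σ_k f_k ((Uᵀw)_k)²`.
[folklore] -/
theorem dotProduct_conj_diagonal_mulVec (U : Matrix n n ℝ) (f : n → ℝ) (w : n → ℝ) :
    w ⬝ᵥ ((U * Matrix.diagonal f * star U) *ᵥ w) = ∑ k, f k * ((star U) *ᵥ w) k ^ 2 := by
  have hT : Uᵀ = star U := by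
    rw [Matrix.star_eq_conjTranspose, Matrix.conjTranspose_eq_transpose_of_trivial]
  rw [← Matrix.mulVec_mulVec, ← Matrix.mulVec_mulVec, Matrix.dotProduct_mulVec, ← Matrix.mulVec_transpose, hT]
  simp only [dotProduct, Matrix.mulVec_diagonal]
  exact Finset.sum_congr rfl fun k _ => by ring

/-- **(2.24), the remainder as a FORM inequality**: for a real positive definite `C` with eigenvalues `λ_k ≤ c`,
`α ≥ 0`, `αc ≤ ½`, the covariance `(C⁻¹ − αI)⁻¹ = (1 − αC)⁻¹C` (`inv_inv_sub_smul_eq`) exceeds `C` by a form `R`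
with `0 ≤ ⟨w, Rw⟩ ≤ 2αc·⟨w, Cw⟩` (hence `≤ 2αc²‖w‖²`): "the remainder can be estimated by ½O(α₅)‖ZX‖²" with
`O(α₅) = 4α₅‖C‖²·‖Γ_k‖²` explicit up to the operator norms of the paper. [cite: Balaban1988RG2Cluster, (2.24) p.17] -/
theorem remainder_form_le {C : Matrix n n ℝ} (hC : C.PosDef) {α c : ℝ} (hα0 : 0 ≤ α)
    (hc : ∀ k, hC.1.eigenvalues k ≤ c) (hαc : α * c ≤ 1 / 2) (w : n → ℝ) :
    0 ≤ w ⬝ᵥ (((1 - α • C)⁻¹ * C - C) *ᵥ w) ∧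
      w ⬝ᵥ (((1 - α • C)⁻¹ * C - C) *ᵥ w) ≤ 2 * α * c * (w ⬝ᵥ (C *ᵥ w)) := by
  obtain ⟨ev, hev⟩ : ∃ ev : n → ℝ, ev = hC.1.eigenvalues := ⟨_, rfl⟩
  obtain ⟨U, hU⟩ : ∃ U : Matrix n n ℝ, U = (hC.1.eigenvectorUnitary : Matrix n n ℝ) := ⟨_, rfl⟩
  have hpos : ∀ k, 0 < ev k := by rw [hev]; exact hC.eigenvalues_pos
  rw [← hev] at hc
  have hUU : U * star U = 1 := by rw [hU]; exact Unitary.coe_mul_star_self hC.1.eigenvectorUnitary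
  have hUU' : star U * U = 1 := by rw [hU]; exact Unitary.coe_star_mul_self hC.1.eigenvectorUnitary
  have hspec : C = U * Matrix.diagonal ev * star U := by
    have h := hC.1.spectral_theorem
    rw [Unitary.conjStarAlgAut_apply, ← hU] at h
    have hD : (Matrix.diagonal (RCLike.ofReal ∘ hC.1.eigenvalues) : Matrix n n ℝ) = Matrix.diagonal ev := by
      rw [hev]
      ext i j
      simp only [diagonal_apply, Function.comp_apply, RCLike.ofReal_real_eq_id, id]
    rw [hD] at h
    exact h
  have hα : ∀ k, α * ev k ≤ 1 / 2 := fun k => (mul_le_mul_of_nonneg_left (hc k) hα0).trans hαc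
  have hne : ∀ k, 1 - α * ev k ≠ 0 := fun k => by have := hα k; intro h0; linarith
  -- `1 - α • C` and its inverse, spectrally
  have h1 : 1 - α • C = U * Matrix.diagonal (fun k => 1 - α * ev k) * star U := by
    have : (1 : Matrix n n ℝ) - α • Matrix.diagonal ev = Matrix.diagonal fun k => 1 - α * ev k := by
      ext i j
      simp only [Matrix.sub_apply, Matrix.smul_apply, Matrix.one_apply, diagonal_apply, smul_eq_mul]
      split_ifs <;> simp
    rw [hspec, ← this, mul_sub, sub_mul, mul_one, hUU, Matrix.mul_smul, Matrix.smul_mul]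
  have hinv : (1 - α • C)⁻¹ = U * Matrix.diagonal (fun k => (1 - α * ev k)⁻¹) * star U := by
    refine Matrix.inv_eq_right_inv ?_
    rw [h1]
    calc U * Matrix.diagonal (fun k => 1 - α * ev k) * star U
          * (U * Matrix.diagonal (fun k => (1 - α * ev k)⁻¹) * star U)
        = U * (Matrix.diagonal (fun k => 1 - α * ev k) * (star U * U)
            * Matrix.diagonal (fun k => (1 - α * ev k)⁻¹)) * star U := by simp only [Matrix.mul_assoc]
      _ = 1 := by
          rw [hUU', Matrix.mul_one, diagonal_mul_diagonal]
          have : (fun k => (1 - α * ev k) * (1 - α * ev k)⁻¹) = fun _ => (1 : ℝ) :=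
            funext fun k => mul_inv_cancel₀ (hne k)
          rw [this, diagonal_one, Matrix.mul_one, hUU]
  -- the remainder, spectrally
  have hR : (1 - α • C)⁻¹ * C - C
      = U * Matrix.diagonal (fun k => (1 - α * ev k)⁻¹ * ev k - ev k) * star U := by
    rw [hinv]
    conv_lhs => rw [hspec]
    calc U * Matrix.diagonal (fun k => (1 - α * ev k)⁻¹) * star U * (U * Matrix.diagonal ev * star U)
          - U * Matrix.diagonal ev * star U
        = U * (Matrix.diagonal (fun k => (1 - α * ev k)⁻¹) * (star U * U) * Matrix.diagonal ev) * star U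
            - U * Matrix.diagonal ev * star U := by simp only [Matrix.mul_assoc]
      _ = U * Matrix.diagonal (fun k => (1 - α * ev k)⁻¹ * ev k - ev k) * star U := by
          rw [hUU', Matrix.mul_one, diagonal_mul_diagonal, ← diagonal_sub, Matrix.mul_sub, Matrix.sub_mul]
  rw [hR, dotProduct_conj_diagonal_mulVec]
  conv_rhs => rw [hspec]
  rw [dotProduct_conj_diagonal_mulVec, Finset.mul_sum]
  refine ⟨Finset.sum_nonneg fun k _ => mul_nonneg ?_ (sq_nonneg _), Finset.sum_le_sum fun k _ => ?_⟩
  · have h := (remainder_scalar_le (t := ev k) hα0 (hα k)).1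
    rwa [mul_comm (ev k)] at h
  · have h := (remainder_scalar_le (t := ev k) hα0 (hα k)).2
    rw [mul_comm (ev k)] at h
    calc ((1 - α * ev k)⁻¹ * ev k - ev k) * ((star U) *ᵥ w) k ^ 2
        ≤ 2 * α * ev k ^ 2 * ((star U) *ᵥ w) k ^ 2 := mul_le_mul_of_nonneg_right h (sq_nonneg _)
      _ ≤ 2 * α * (c * ev k) * ((star U) *ᵥ w) k ^ 2 := by
          refine mul_le_mul_of_nonneg_right ?_ (sq_nonneg _)
          rw [sq]
          exact mul_le_mul_of_nonneg_left (mul_le_mul_of_nonneg_right (hc k) (hpos k).le) (by positivity)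
      _ = 2 * α * c * (ev k * ((star U) *ᵥ w) k ^ 2) := by ring

end remainderForm

end Literature.MathematicalPhysics.QuantumFieldTheory.Balaban1983to89.B13PerturbativeStep

end
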